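import Literature.NumberTheory.Automorphic.NewformAdelisationHeckeLocal
import Literature.NumberTheory.Automorphic.ParabolicGL
import HarnessLib

/-!
# The cosets of `GL₂(𝒪) diag(ϖ,1) GL₂(𝒪)` seen from the Borel subgroup

Topic `NumberTheory/Automorphic`; namespace `Literature.NumberTheory.Automorphic`.  Local
(discretely valued field `F`, uniformiser `ϖ`, `K = GL₂(𝒪)` = `GL2Int F`, `B` the upper
triangular Borel subgroup `borelGL2 F`, `B_K = B ∩ K`).  With `t₁ = diag(ϖ, 1)` (`heckeLocalDiag`)
and `t₂ = diag(1, ϖ)` (`heckeLocalDiag'`), everything proved: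

* `conj_heckeLocalDiag'_mem` — **`t₂` contracts `B_K`**: `t₂⁻¹ B_K t₂ ⊆ B_K`
  (`t₂⁻¹ (a b; 0 d) t₂ = (a bϖ; 0 d)`);
* `exists_borelInt_mul_heckeLocalDiag` — for `l ∈ B_K`, `l t₁ K = y_i K` for some FINITE index
  `i` (`y_i = (ϖ b_i; 0 1) = n(b_i) t₁`, `n(b_i) ∈ B_K`), never `y_∞ K = t₂ K`
  (`borelInt_mul_heckeLocalDiag_ne`);
* `mul_heckeLocalDiag'_coset_eq` — for `l ∈ B_K`, `l t₂ K = t₂ K`;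
* `orbit_heckeLocalDiag_eq` — **the `K`-orbit of `t₁ K` in `GL₂(F) ⧸ K` is the union of the
  `B_K`-translates `{l t₁ K : l ∈ B_K}` and the single coset `{t₂ K}`**, the two pieces being
  disjoint (`borelInt_mul_heckeLocalDiag_ne`).

That is: restricted to the Borel subgroup, the unramified Hecke operator `T_{ϖ,1} = [K t₁ K]` of
`GL₂` is the SUM of the two Borel Hecke operators `[B_K t₁ B_K]` (of degree `q`) and `[B_K t₂ B_K]`
(of degree `1`) — the group theory behind the computation of the Hecke eigenvalues of the boundary
/ Eisenstein cohomology of `GL₂` [Harder1987, §2], cf. the tree's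
`HeckeOperatorUnipotentInvariantGL2` (same computation on left-`N`-invariant functions).

## References

* D. Bump, *Automorphic forms and representations* (1997), §4.6, (6.4), p. 494 [Bump1997].
* G. Harder, *Eisenstein cohomology of arithmetic groups. The case GL₂*, Invent. Math. 89 (1987), §2
  [Harder1987].
-/

noncomputable section

open Matrix.GeneralLinearGroup

namespace Literature.NumberTheory.Automorphic

/-! ### The Borel subgroup of `GL₂` and the element `t₂ = diag(1, ϖ)` -/

section Borel

variable (F : Type*) [Field F]

/-- The upper triangular Borel subgroup `B ≤ GL₂(F)` (the tree's standard parabolic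
`standardParabolicGL F id`). [folklore] -/
abbrev borelGL2 : Subgroup (GL (Fin 2) F) := standardParabolicGL F (id : Fin 2 → Fin 2)

variable {F}

/-- `g ∈ B ↔ g₁₀ = 0`. [folklore] -/
theorem mem_borelGL2_iff {g : GL (Fin 2) F} :
    g ∈ borelGL2 F ↔ (g : Matrix (Fin 2) (Fin 2) F) 1 0 = 0 := by
  rw [mem_standardParabolicGL_iff]
  constructor
  · intro h
    exact h (show (id 0 : Fin 2) < id 1 by decide)
  · intro h i j hij
    fin_cases i <;> fin_cases j
    · exact absurd hij (lt_irrefl _)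
    · exact absurd hij (by decide)
    · exact h
    · exact absurd hij (lt_irrefl _)

/-- `n(x) = (1 x; 0 1) ∈ B`. [folklore] -/
theorem upperRightHom_mem_borelGL2 (x : F) : (upperRightHom x : GL (Fin 2) F) ∈ borelGL2 F := by
  rw [mem_borelGL2_iff, upperRightHom_apply]
  rfl

variable (ϖ : F) (hϖ0 : ϖ ≠ 0)

/-- The element `t₂ = diag(1, ϖ) ∈ GL₂(F)` (equal to the representative `y_∞` of
`NewformAdelisationHeckeLocal`, `heckeLocalRep_none_eq_heckeLocalDiag'`). [folklore] -/
def heckeLocalDiag' : GL (Fin 2) F :=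
  ⟨!![1, 0; 0, ϖ], !![1, 0; 0, ϖ⁻¹],
    by ext r c; fin_cases r <;> fin_cases c <;> simp [Matrix.mul_apply, Fin.sum_univ_two, hϖ0],
    by ext r c; fin_cases r <;> fin_cases c <;> simp [Matrix.mul_apply, Fin.sum_univ_two, hϖ0]⟩

/-- Entries of `t₂`. [folklore] -/
@[simp]
theorem coe_heckeLocalDiag' :
    ((heckeLocalDiag' ϖ hϖ0 : GL (Fin 2) F) : Matrix (Fin 2) (Fin 2) F) = !![1, 0; 0, ϖ] := rfl

/-- Entries of `t₂⁻¹`. [folklore] -/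
@[simp]
theorem coe_heckeLocalDiag'_inv :
    (((heckeLocalDiag' ϖ hϖ0)⁻¹ : GL (Fin 2) F) : Matrix (Fin 2) (Fin 2) F) = !![1, 0; 0, ϖ⁻¹] := rfl

/-- `y_∞ = t₂`. [folklore] -/
theorem heckeLocalRep_none_eq_heckeLocalDiag' {ι : Type*} (b : ι → F) :
    heckeLocalRep ϖ b hϖ0 none = heckeLocalDiag' ϖ hϖ0 := by
  ext r c
  rw [coe_heckeLocalRep_none, coe_heckeLocalDiag']

/-- `t₁ = diag(ϖ, 1) ∈ B`. [folklore] -/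
theorem heckeLocalDiag_mem_borelGL2 : heckeLocalDiag ϖ hϖ0 ∈ borelGL2 F := by
  rw [mem_borelGL2_iff, coe_heckeLocalDiag]
  rfl

/-- `t₂ = diag(1, ϖ) ∈ B`. [folklore] -/
theorem heckeLocalDiag'_mem_borelGL2 : heckeLocalDiag' ϖ hϖ0 ∈ borelGL2 F := by
  rw [mem_borelGL2_iff, coe_heckeLocalDiag']
  rfl

/-- `y_i = (ϖ b_i; 0 1) ∈ B`. [folklore] -/
theorem heckeLocalRep_some_mem_borelGL2 {ι : Type*} (b : ι → F) (i : ι) :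
    heckeLocalRep ϖ b hϖ0 (some i) ∈ borelGL2 F := by
  rw [mem_borelGL2_iff, coe_heckeLocalRep_some]
  rfl

/-- The entries of an upper triangular `l`: `l = (l₀₀ l₀₁; 0 l₁₁)`. [folklore] -/
theorem coe_eq_of_mem_borelGL2 {l : GL (Fin 2) F} (hl : l ∈ borelGL2 F) :
    (l : Matrix (Fin 2) (Fin 2) F) =
      !![(l : Matrix (Fin 2) (Fin 2) F) 0 0, (l : Matrix (Fin 2) (Fin 2) F) 0 1;
        0, (l : Matrix (Fin 2) (Fin 2) F) 1 1] := by
  rw [mem_borelGL2_iff] at hl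
  ext r c; fin_cases r <;> fin_cases c <;> simp [hl]

/-- `t₂⁻¹ (a b; 0 d) t₂ = (a bϖ; 0 d)`. [folklore] -/
theorem coe_heckeLocalDiag'_inv_mul_mul {l : GL (Fin 2) F} (hl : l ∈ borelGL2 F) :
    (((heckeLocalDiag' ϖ hϖ0)⁻¹ * l * heckeLocalDiag' ϖ hϖ0 : GL (Fin 2) F) :
        Matrix (Fin 2) (Fin 2) F) =
      !![(l : Matrix (Fin 2) (Fin 2) F) 0 0, (l : Matrix (Fin 2) (Fin 2) F) 0 1 * ϖ;
        0, (l : Matrix (Fin 2) (Fin 2) F) 1 1] := by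
  have key : ∀ a : F, ϖ⁻¹ * a * ϖ = a := fun a => by
    rw [mul_right_comm, inv_mul_cancel₀ hϖ0, one_mul]
  rw [Units.val_mul, Units.val_mul, coe_heckeLocalDiag'_inv, coe_heckeLocalDiag',
    coe_eq_of_mem_borelGL2 hl]
  ext r c; fin_cases r <;> fin_cases c <;>
    simp [Matrix.mul_apply, Fin.sum_univ_two, key]

/-- `(a b; 0 d) t₂ = t₂ (a bϖ; 0 d)`, in `GL₂(F)`. [folklore] -/
theorem mul_heckeLocalDiag'_eq {l : GL (Fin 2) F} :
    l * heckeLocalDiag' ϖ hϖ0 =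
      heckeLocalDiag' ϖ hϖ0 * ((heckeLocalDiag' ϖ hϖ0)⁻¹ * l * heckeLocalDiag' ϖ hϖ0) := by
  group

end Borel

/-! ### Over a discretely valued field -/

section Valued

variable {F : Type*} [Field F] [Valued F (WithZero (Multiplicative ℤ))]
variable (ϖ : F) {ι : Type*} (b : ι → F) (hϖ0 : ϖ ≠ 0)

/-- Diagonal entries of `l ∈ B ∩ K` are units: `|l₀₀| = |l₁₁| = 1`. [folklore] -/
theorem valuation_diag_eq_one_of_mem {l : GL (Fin 2) F} (hlB : l ∈ borelGL2 F) (hlK : l ∈ GL2Int F) :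
    Valued.v ((l : Matrix (Fin 2) (Fin 2) F) 0 0) = 1 ∧
      Valued.v ((l : Matrix (Fin 2) (Fin 2) F) 1 1) = 1 := by
  have hdet := valuation_det_eq_one_of_mem hlK
  rw [det_fin_two_val, (mem_borelGL2_iff).1 hlB, mul_zero, sub_zero, Valuation.map_mul] at hdet
  obtain ⟨h1, -, -⟩ := hlK
  have ha := h1 0 0
  have hd := h1 1 1
  constructor
  · refine le_antisymm ha ?_
    by_contra hlt
    rw [not_le] at hlt
    have : Valued.v ((l : Matrix (Fin 2) (Fin 2) F) 0 0) *
        Valued.v ((l : Matrix (Fin 2) (Fin 2) F) 1 1) < 1 :=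
      calc _ ≤ Valued.v ((l : Matrix (Fin 2) (Fin 2) F) 0 0) * 1 := mul_le_mul' le_rfl hd
        _ < 1 := by rw [mul_one]; exact hlt
    rw [hdet] at this
    exact lt_irrefl _ this
  · refine le_antisymm hd ?_
    by_contra hlt
    rw [not_le] at hlt
    have : Valued.v ((l : Matrix (Fin 2) (Fin 2) F) 0 0) *
        Valued.v ((l : Matrix (Fin 2) (Fin 2) F) 1 1) < 1 :=
      calc _ ≤ 1 * Valued.v ((l : Matrix (Fin 2) (Fin 2) F) 1 1) := mul_le_mul' ha le_rfl
        _ < 1 := by rw [one_mul]; exact hlt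
    rw [hdet] at this
    exact lt_irrefl _ this

/-- **`t₂` contracts `B ∩ K`**: `t₂⁻¹ l t₂ ∈ K` for `l ∈ B ∩ K` (and it lies in `B`), provided
`|ϖ| ≤ 1`. [cite: Harder1987, §2] -/
theorem conj_heckeLocalDiag'_mem (hϖ1 : Valued.v ϖ ≤ 1) {l : GL (Fin 2) F} (hlB : l ∈ borelGL2 F)
    (hlK : l ∈ GL2Int F) :
    (heckeLocalDiag' ϖ hϖ0)⁻¹ * l * heckeLocalDiag' ϖ hϖ0 ∈ borelGL2 F ⊓ GL2Int F := by
  refine Subgroup.mem_inf.2 ⟨?_, ?_⟩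
  · rw [mem_borelGL2_iff, coe_heckeLocalDiag'_inv_mul_mul ϖ hϖ0 hlB]
    rfl
  · have hdet := valuation_det_eq_one_of_mem hlK
    rw [det_fin_two_val, (mem_borelGL2_iff).1 hlB, mul_zero, sub_zero] at hdet
    obtain ⟨h1, -, -⟩ := hlK
    refine mem_GL2Int_of_entries (fun i j => ?_) ?_
    · rw [coe_heckeLocalDiag'_inv_mul_mul ϖ hϖ0 hlB]
      fin_cases i <;> fin_cases j
      · simpa using h1 0 0
      · simpa [Valuation.map_mul] using mul_le_one' (h1 0 1) hϖ1
      · simp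
      · simpa using h1 1 1
    · rw [det_fin_two_val, coe_heckeLocalDiag'_inv_mul_mul ϖ hϖ0 hlB]
      simpa using hdet

/-- For `l ∈ B ∩ K`: `l t₂ = t₂ l'` with `l' = t₂⁻¹ l t₂ ∈ B ∩ K`; in particular `l t₂ K = t₂ K`.
[cite: Harder1987, §2] -/
theorem mul_heckeLocalDiag'_coset_eq (hϖ1 : Valued.v ϖ ≤ 1) {l : GL (Fin 2) F} (hlB : l ∈ borelGL2 F)
    (hlK : l ∈ GL2Int F) :
    ((l * heckeLocalDiag' ϖ hϖ0 : GL (Fin 2) F) : GL (Fin 2) F ⧸ GL2Int F) =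
      ((heckeLocalDiag' ϖ hϖ0 : GL (Fin 2) F) : GL (Fin 2) F ⧸ GL2Int F) := by
  rw [mul_heckeLocalDiag'_eq ϖ hϖ0 (l := l)]
  exact QuotientGroup.mk_mul_of_mem _ (Subgroup.mem_inf.1 (conj_heckeLocalDiag'_mem ϖ hϖ0 hϖ1 hlB hlK)).2

/-- **`B ∩ K`-translates of `t₁ K` are cosets `y_i K` with `i` finite**: for `l ∈ B ∩ K` there is
`i` with `y_i⁻¹ l t₁ ∈ K` (row reduction; the case `y_∞` is excluded because `l₁₁` is a unit).
[cite: Bump1997, §4.6, (6.4), p. 494] -/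
theorem exists_borelInt_mul_heckeLocalDiag (hϖ : Valued.v ϖ = WithZero.exp (-1 : ℤ))
    (hbint : ∀ i, Valued.v (b i) ≤ 1) (hb : ∀ x : F, Valued.v x ≤ 1 → ∃ i, Valued.v (x - b i) < 1)
    {l : GL (Fin 2) F} (hlB : l ∈ borelGL2 F) (hlK : l ∈ GL2Int F) :
    ∃ i : ι, (heckeLocalRep ϖ b hϖ0 (some i))⁻¹ * l * heckeLocalDiag ϖ hϖ0 ∈ GL2Int F := by
  obtain ⟨j, hj⟩ := exists_heckeLocalRep_inv_mul_mul_mem ϖ b hϖ0 hϖ hbint hb hlK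
  cases j with
  | some i => exact ⟨i, hj⟩
  | none =>
    exfalso
    obtain ⟨h1, -, -⟩ := hj
    have h11 := h1 1 1
    have hd := (valuation_diag_eq_one_of_mem hlB hlK).2
    have hmat : (((heckeLocalRep ϖ b hϖ0 none)⁻¹ * l * heckeLocalDiag ϖ hϖ0 : GL (Fin 2) F) :
        Matrix (Fin 2) (Fin 2) F) 1 1 = (l : Matrix (Fin 2) (Fin 2) F) 1 1 * ϖ⁻¹ := by
      rw [Units.val_mul, Units.val_mul, coe_heckeLocalRep_none_inv, coe_heckeLocalDiag,
        coe_eq_of_mem_borelGL2 hlB]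
      simp [Matrix.mul_apply, Fin.sum_univ_two, mul_comm]
    rw [hmat, Valuation.map_mul, hd, one_mul, map_inv₀, hϖ, ← WithZero.exp_neg, neg_neg,
      ← WithZero.exp_zero, WithZero.exp_le_exp] at h11
    omega

/-- Hence `l t₁ K = y_i K = n(b_i) t₁ K` for some `i`, with `n(b_i) ∈ B ∩ K`. [cite: Bump1997, §4.6, (6.4), p. 494] -/
theorem exists_borelInt_mul_heckeLocalDiag_coset_eq (hϖ : Valued.v ϖ = WithZero.exp (-1 : ℤ))
    (hbint : ∀ i, Valued.v (b i) ≤ 1) (hb : ∀ x : F, Valued.v x ≤ 1 → ∃ i, Valued.v (x - b i) < 1)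
    {l : GL (Fin 2) F} (hlB : l ∈ borelGL2 F) (hlK : l ∈ GL2Int F) :
    ∃ i : ι, ((l * heckeLocalDiag ϖ hϖ0 : GL (Fin 2) F) : GL (Fin 2) F ⧸ GL2Int F) =
      ((heckeLocalRep ϖ b hϖ0 (some i) : GL (Fin 2) F) : GL (Fin 2) F ⧸ GL2Int F) := by
  obtain ⟨i, hi⟩ := exists_borelInt_mul_heckeLocalDiag ϖ b hϖ0 hϖ hbint hb hlB hlK
  refine ⟨i, ?_⟩
  rw [eq_comm, QuotientGroup.eq, ← mul_assoc]
  exact hi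

/-- **The two kinds of cosets are distinct**: `l t₁ K ≠ l' t₂ K` for `l, l' ∈ B ∩ K`.
[cite: Bump1997, §4.6, (6.4), p. 494] -/
theorem borelInt_mul_heckeLocalDiag_ne (hϖ : Valued.v ϖ = WithZero.exp (-1 : ℤ))
    (hbint : ∀ i, Valued.v (b i) ≤ 1) (hb : ∀ x : F, Valued.v x ≤ 1 → ∃ i, Valued.v (x - b i) < 1)
    (hbinj : ∀ i j, Valued.v (b i - b j) < 1 → i = j)
    {l l' : GL (Fin 2) F} (hlB : l ∈ borelGL2 F) (hlK : l ∈ GL2Int F) (hl'B : l' ∈ borelGL2 F)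
    (hl'K : l' ∈ GL2Int F) :
    ((l * heckeLocalDiag ϖ hϖ0 : GL (Fin 2) F) : GL (Fin 2) F ⧸ GL2Int F) ≠
      ((l' * heckeLocalDiag' ϖ hϖ0 : GL (Fin 2) F) : GL (Fin 2) F ⧸ GL2Int F) := by
  have hϖ1 : Valued.v ϖ ≤ 1 := by
    rw [hϖ, ← WithZero.exp_zero, WithZero.exp_le_exp]; omega
  obtain ⟨i, hi⟩ := exists_borelInt_mul_heckeLocalDiag_coset_eq ϖ b hϖ0 hϖ hbint hb hlB hlK
  rw [hi, mul_heckeLocalDiag'_coset_eq ϖ hϖ0 hϖ1 hl'B hl'K, ← heckeLocalRep_none_eq_heckeLocalDiag' ϖ hϖ0 b,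
    Ne, QuotientGroup.eq]
  intro h
  exact Option.some_ne_none i (heckeLocalRep_eq_of_inv_mul_mem ϖ b hϖ0 hϖ hbinj h)

/-- `t₂ K = w t₁ K` lies in the `K`-orbit of `t₁ K` (`w` the Weyl element). [folklore] -/
theorem heckeLocalDiag'_mem_orbit :
    ((heckeLocalDiag' ϖ hϖ0 : GL (Fin 2) F) : GL (Fin 2) F ⧸ GL2Int F) ∈
      MulAction.orbit (GL2Int F) ((heckeLocalDiag ϖ hϖ0 : GL (Fin 2) F) : GL (Fin 2) F ⧸ GL2Int F) := by
  refine ⟨⟨swapGL, swapGL_mem_GL2Int⟩, ?_⟩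
  change (((swapGL : GL (Fin 2) F) * heckeLocalDiag ϖ hϖ0 : GL (Fin 2) F) : GL (Fin 2) F ⧸ GL2Int F) = _
  rw [← heckeLocalRep_none_eq_heckeLocalDiag' ϖ hϖ0 (fun _ : Unit => (0 : F)),
    heckeLocalRep_none_eq, QuotientGroup.eq]
  have hgrp : (heckeLocalDiag ϖ hϖ0)⁻¹ * (swapGL : GL (Fin 2) F)⁻¹ *
      (swapGL * heckeLocalDiag ϖ hϖ0 * swapGL⁻¹) = (swapGL : GL (Fin 2) F)⁻¹ := by group
  rw [mul_inv_rev, hgrp]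
  exact Subgroup.inv_mem _ swapGL_mem_GL2Int

/-- **The `K`-orbit of `t₁ K` from the Borel**: it is the union of the `B ∩ K`-translates
`{l t₁ K : l ∈ B ∩ K}` and the coset `t₂ K`. [cite: Bump1997, §4.6, (6.4), p. 494] [cite: Harder1987, §2] -/
theorem orbit_heckeLocalDiag_eq (hϖ : Valued.v ϖ = WithZero.exp (-1 : ℤ))
    (hbint : ∀ i, Valued.v (b i) ≤ 1) (hb : ∀ x : F, Valued.v x ≤ 1 → ∃ i, Valued.v (x - b i) < 1) :
    MulAction.orbit (GL2Int F) ((heckeLocalDiag ϖ hϖ0 : GL (Fin 2) F) : GL (Fin 2) F ⧸ GL2Int F) =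
      {c | ∃ l ∈ borelGL2 F ⊓ GL2Int F,
          c = ((l * heckeLocalDiag ϖ hϖ0 : GL (Fin 2) F) : GL (Fin 2) F ⧸ GL2Int F)} ∪
        {((heckeLocalDiag' ϖ hϖ0 : GL (Fin 2) F) : GL (Fin 2) F ⧸ GL2Int F)} := by
  ext c
  constructor
  · intro hc
    obtain ⟨k, rfl⟩ := MulAction.mem_orbit_iff.1 hc
    obtain ⟨j, hj⟩ := exists_heckeLocalRep_inv_mul_mul_mem ϖ b hϖ0 hϖ hbint hb k.2
    have hk : ((k : GL (Fin 2) F) • ((heckeLocalDiag ϖ hϖ0 : GL (Fin 2) F) : GL (Fin 2) F ⧸ GL2Int F)) =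
        ((heckeLocalRep ϖ b hϖ0 j : GL (Fin 2) F) : GL (Fin 2) F ⧸ GL2Int F) := by
      rw [MulAction.Quotient.smul_coe, smul_eq_mul, eq_comm, QuotientGroup.eq, ← mul_assoc]
      exact hj
    change ((k : GL (Fin 2) F) • ((heckeLocalDiag ϖ hϖ0 : GL (Fin 2) F) : GL (Fin 2) F ⧸ GL2Int F)) ∈ _
    rw [hk]
    cases j with
    | none =>
      right
      rw [heckeLocalRep_none_eq_heckeLocalDiag']
      rfl
    | some i =>
      left
      refine ⟨upperRightHom (b i), ⟨upperRightHom_mem_borelGL2 _, upperRightHom_mem_GL2Int (hbint i)⟩, ?_⟩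
      rw [heckeLocalRep_some_eq]
  · rintro (⟨l, hl, rfl⟩ | h)
    · exact MulAction.mem_orbit_iff.2 ⟨⟨l, (Subgroup.mem_inf.1 hl).2⟩, rfl⟩
    · rw [Set.mem_singleton_iff] at h
      rw [h]
      exact heckeLocalDiag'_mem_orbit ϖ hϖ0

end Valued

end Literature.NumberTheory.Automorphic
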